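import Summits.HodgeConjecture.HodgeConjecture.Theses.DoublyPolarisedTransport
import Summits.HodgeConjecture.HodgeConjecture.Theorems.Ring2AbelianAllAndreTwistedSquareEvenInhabitants
import Summits.HodgeConjecture.HodgeConjecture.Theorems.Ring2AbelianAllWeilSimilarAnchors
import Summits.HodgeConjecture.HodgeConjecture.Theorems.Ring2AbelianAllWeilSignCells
import Literature.AlgebraicGeometry.VanGeemen1994.HyperbolicOfSplitDiscriminant
import HarnessLib

/-!
# `DoublyPolarisedSimilarAnchors` (№8c X2, stmt-HodgeConjecture-23603) holds — the twisted cube `E₀³ × Ē₀³`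

HONEST FRAMING: this closes the ANCHOR-SUPPLY crux X2 of route `DoublyPolarisedTransport` (№8c, bears on rung H2
`SevenfoldWeilCensus.WeilSixfolds`) and nothing more: no case of the Hodge conjecture, no rung and no summit conjunct is
proved here; the route's mathematical content is its other crux X1 (`DoublyPolarisedLiftableCarriers`, stmt-23602), untouched.
`RankFourFaces.CMAbelianHodge` (HC_CM) is not used and not affected.

For every NON-hyperbolic `(A, φ)` of Weil type `(3, d)` (no `K`-symmetrised hyperplane class hyperbolic) carrying a
non-zero `(3,3)` Weil class, the polarized twisted square `P = T × T`, `T = E₀³` (`E₀ = ℂ/(ℤ + ℤ√-d)`, diagonal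
`K`-structure `φ_T`, `Φ = φ_T × (-φ_T)`), is a DOUBLY-POLARISED ANCHOR Weil-similar to `(A, φ, h_A)`:
* `h_A := d·e_A^*a_A + φ^*e_A^*a_A` for any projective embedding `e_A` of `A` has a discriminant class `δ`
  (`exists_hasWeilDiscriminantNondeg_weilSign`), of sign `(-1)³`, and `δ ≠ [(-1)³]` because `A` is non-split
  (Landherr ⟸ on the carriers, `IsWeilType.isSplitWeilType_of_hasWeilDiscriminantNondeg_split`); so `δ = [-m]`, `m ≥ 1`
  (`exists_nat_mk_neg_eq`);
* ONE variety `T × T` carries, for every weight `m' ≥ 1`, a Segre embedding of class `[(-m')³] = [-m']`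
  (`exists_hasWeilDiscriminantNondeg_twistedSquare`): weight `m` gives `h` of class `δ` — Weil-similar to `h_A`
  (`isWeilSimilar_of_hasWeilDiscriminantNondeg`, Landherr) and NOT hyperbolic (`not_isHyperbolicWeilType_of_hasWeilDiscriminantNondeg_ne`);
  weight `1` gives the split class, hence a hyperbolic `h'` (`isSplitWeilType_of_hasWeilDiscriminantNondeg_split`);
* `T × T` is of Weil type `(3, d)` (`isWeilType_twistedSquare`), so its Weil plane has a non-zero rational `(3,3)` class.

No new mathematics: the ring-2 desk's twisted-square anchors + van Geemen 5.2–5.4 / Landherr on the tree's carriers.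
[cite: vanGeemen1994HodgeAV, 4.14, Lemma 5.2 (3)–(4), 5.3–5.4 (5.4.1)] [cite: Landherr1936HermitianForms]
[cite: Deligne1982HodgeCycles, proof of Thm. 4.8 and Remark 4.10] [cite: Markman2025SurveySecant, §11.5 Steps 1–2]
-/

noncomputable section

open CategoryTheory
open Literature.AlgebraicGeometry Literature.AlgebraicGeometry.Motives
open Literature.AlgebraicGeometry.HodgeTheory
open Literature.AlgebraicGeometry.VanGeemen1994
open Summit.HodgeConjecture.HodgeConjecture.Ring2.AbelianAll

namespace Summit.HodgeConjecture.HodgeConjecture.Theses.DoublyPolarisedTransport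

/-- **X2 holds**: every non-hyperbolic Weil sixfold `(A, φ, h_A)` with a non-zero `(3,3)` Weil class is Weil-similar to the
doubly-polarised twisted cube `(E₀³ × Ē₀³, Φ, h, h')` (`h` of the same discriminant class, not hyperbolic; `h'` hyperbolic).
[cite: vanGeemen1994HodgeAV, Lemma 5.2 (3)–(4) and 5.3–5.4] [cite: Landherr1936HermitianForms]
[cite: Deligne1982HodgeCycles, proof of Thm. 4.8 and Remark 4.10] -/
theorem doublyPolarisedSimilarAnchors_holds : DoublyPolarisedSimilarAnchors := by
  intro d hd A φ hA hφ hns hwA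
  obtain ⟨wA, hwA, hwA0, hwAH⟩ := hwA
  have n3 : (0 : ℕ) < 3 := by norm_num
  -- `(A, φ)` is of Weil type `(3, d)` (Deligne–Milne 4.4 ⇒)
  have hW' : IsWeilType A φ 3 d := isWeilType_of_weilClass_ne_zero n3 hd hA hφ hwA hwA0 hwAH
  -- a projective embedding of `A` with a non-zero rational ambient class
  obtain ⟨eA, aA, haA, haA0, -⟩ := exists_weightedSegreEmbedding_self_prod A
  -- its discriminant class, of sign `(-1)³`
  obtain ⟨δ, hδA, hsign⟩ := exists_hasWeilDiscriminantNondeg_weilSign hW' eA haA haA0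
  -- … which is not the split class, `A` being non-split
  have hne : δ ≠ QuotientGroup.mk ((-1 : ℚˣ) ^ 3) := by
    rintro rfl
    obtain ⟨-, e, a, ha, ha0, hh⟩ :=
      Literature.AlgebraicGeometry.VanGeemen1994.IsWeilType.isSplitWeilType_of_hasWeilDiscriminantNondeg_split
        hW' eA haA haA0 hδA
    exact hns e a ha ha0 hh
  -- `δ = [-m]` for a positive integer `m`
  obtain ⟨q, rfl⟩ := QuotientGroup.mk_surjective δ
  have hq : (q : ℚ) < 0 := by
    rw [weilSign_mk] at hsign
    have h3 : ((-1 : ℤˣ) ^ 3) = -1 := Odd.neg_one_pow ⟨1, by norm_num⟩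
    exact (ratSign_eq_neg_one_iff q).1 (hsign.trans h3)
  obtain ⟨m, hm, hmq⟩ := exists_nat_mk_neg_eq (d := d) q hq
  -- the CM curve `E₀ = ℂ/(ℤ + ℤ√-d)` and `T = E₀³` with its diagonal `K`-structure
  obtain ⟨E₀, ψ₀, hE, hψ⟩ := Literature.NumberTheory.EllipticCurves.CMEndomorphism.exists_cmCurve_sqrt_neg d hd
  obtain ⟨φT, hφT⟩ := exists_sq_eq_neg_powSucc ψ₀ hψ 2
  have hT : (E₀.powSucc 2).dim = 2 + 1 := by rw [dim_powSucc', hE, mul_one]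
  -- `P = T × T`, `Φ = φ_T × (-φ_T)`: a Weil sixfold
  have hPdim : ((E₀.powSucc 2).prod (E₀.powSucc 2)).dim = 2 * 3 := dim_twistedSquare hT
  have hΦ := twistedSquare_comp_self hφT
  have hWP : IsWeilType ((E₀.powSucc 2).prod (E₀.powSucc 2))
      (AbelianVariety.prodLift (AbelianVariety.fst (E₀.powSucc 2) (E₀.powSucc 2) ≫ φT)
        (AbelianVariety.snd (E₀.powSucc 2) (E₀.powSucc 2) ≫ (-φT))) 3 d :=
    isWeilType_twistedSquare n3 hT hd hφT
  -- the weighted Segre embeddings of `T × T`: weight `m'` has class `[(-m')³]`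
  obtain ⟨eT, aT, haT, haT0, hfam⟩ := exists_hasWeilDiscriminantNondeg_twistedSquare (m₀ := 2) (by norm_num) hT hd hφT
  -- weight `1`: the split class `[(-1)³]`, hence a hyperbolic `K`-symmetrised hyperplane class `h'`
  obtain ⟨e₁, a₁, w₁, ha₁, ha₁0, hw₁, -, hN₁⟩ := hfam 1 one_pos
  have hw₁' : w₁ = (-1 : ℚˣ) ^ 3 := by
    ext
    rw [hw₁]
    push_cast
    norm_num
  rw [hw₁'] at hN₁
  obtain ⟨-, e', a', ha', ha'0, hhyp⟩ :=
    Literature.AlgebraicGeometry.VanGeemen1994.IsWeilType.isSplitWeilType_of_hasWeilDiscriminantNondeg_split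
      hWP e₁ ha₁ ha₁0 hN₁
  -- weight `m`: class `[(-m)³] = [-m] = δ`
  obtain ⟨e, a, w, ha, ha0, hw, -, hN⟩ := hfam m hm
  have hwm : w = (-Units.mk0 (m : ℚ) (Nat.cast_ne_zero.2 hm.ne')) ^ (2 * 1 + 1) := by
    ext
    rw [hw]
    simp only [Units.val_pow_eq_pow_val, Units.val_neg, Units.val_mk0]
  have hwδ : (QuotientGroup.mk w : weilNormResidueGroup d) = QuotientGroup.mk q := by
    rw [hwm, weilNormResidueGroup_mk_pow_odd, hmq]
  rw [hwδ] at hN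
  -- `h` is not hyperbolic (class `δ ≠ [(-1)³]`, van Geemen (5.4.1) ⟸)
  have hnot := not_isHyperbolicWeilType_of_hasWeilDiscriminantNondeg_ne n3 hPdim hd hΦ e ha ha0 hN hne
  -- a non-zero rational `(3,3)` class of the Weil plane of `T × T`
  obtain ⟨w₀, hw₀, hw₀0, hw₀Q⟩ := exists_isRationalClass_ne_zero_mem_weilClassesOf n3 hPdim hd hΦ
  have hw₀H := hWP.isOfHodgeType_of_mem_weilClassesOf hw₀
  -- Landherr: same class `δ` ⟹ Weil-similar
  have hsim := isWeilSimilar_of_hasWeilDiscriminantNondeg hWP hW' e ha ha0 eA haA haA0 hN hδA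
  exact ⟨eA, aA, (E₀.powSucc 2).prod (E₀.powSucc 2), _, e, e', a, a', w₀, haA, haA0, hPdim, hΦ, ha, ha0, ha', ha'0,
    hw₀, hw₀Q, hw₀0, hw₀H, hhyp, hnot, hsim⟩

end Summit.HodgeConjecture.HodgeConjecture.Theses.DoublyPolarisedTransport

end
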